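import Literature.NumberTheory.Transcendental.KaehlerLefschetzOperatorProofs
import Literature.NumberTheory.Transcendental.KaehlerHodgeLaplacianDProofs
import Literature.NumberTheory.Transcendental.DolbeaultIntegrabilityProofs
import Literature.NumberTheory.Transcendental.KaehlerHodgeTypeProofs

/-!
# The operator `P = [∂̄*, L] - i∂`: locality, additivity, vanishing of `∂` at a point

Bookkeeping for the proof of the Kähler identity `[∂̄*, L] = i∂` (Voisin (2002), Lemma 6.6 /
Prop. 6.5) by the test-form method: with `L = ω ∧ ·` the Lefschetz operator of the metric
(`KaehlerLefschetzOperatorProofs.lean`, family `G x = gₓ`) and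

  `P β = ∂̄*(L β) - L (∂̄* β) - i ∂β`   (positive degree),   `P₀ f = ∂̄*(L f) - i ∂f`,

* **locality**: `P β x` depends only on the germ of `β` at `x` (`kaehlerP_congr_of_eventuallyEq`;
  `∂`, `∂̄* = -⋆∂⋆` are local, `L` and `⋆` are pointwise);
* **additivity** on smooth forms and finite sums (`kaehlerP_sum`), and with
  `C^∞`-linearity as input, the **frame reduction**: if `P Θᵢ x = 0` for finitely many smooth
  forms `Θᵢ` and `P (ρ • β) x = ρ x • P β x`, then `P (∑ ρᵢ • Θᵢ) x = 0`
  (`kaehlerP_sum_fun_smul_eq_zero`);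
* **vanishing of `∂` at a point** (`dolbeault_apply_eq_zero`): if `d (β^{p,q})` vanishes at `x`
  for all `(p,q)` then `∂β x = 0` (from `∂ = ∑ ((d β^{p,q})^{p+1,q}`), and hence
  `∂̄*β x = 0` when `d ((⋆β)^{p,q}) x = 0` for all `(p,q)`.

Voisin (2002), §6.1.1, proof of Prop. 6.5: "it suffices to check the identity at a point, on
forms with constant coefficients in osculating coordinates".

## References

* C. Voisin, *Hodge Theory and Complex Algebraic Geometry I* (2002), §6.1.1, Prop. 6.5,
  Lemma 6.6. [Voisin2002]
-/

noncomputable section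

open scoped Manifold ContDiff Topology
open Set Finset ContinuousAlternatingMap Function Complex Bundle Module Filter
open Literature.LinearAlgebra.Alternating Literature.Analysis.Complex
open Literature.Geometry.Kaehler

namespace Literature.NumberTheory.Transcendental

set_option quotPrecheck false

set_option hygiene false in
/-- The covector family `θ_B v = ½ B(i v, ·)`. -/
local notation "θE[" B "]" => (2⁻¹ : ℝ) • ContinuousLinearMap.comp B
  ((Complex.I • ContinuousLinearMap.id ℂ E).restrictScalars ℝ)

set_option hygiene false in
/-- The canonical family of the model Lefschetz operator. -/
local notation "LfamE[" B "]" η:max =>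
  ContinuousLinearMap.comp (ContinuousAlternatingMap.alternatizeUncurryFinCLM ℝ E ℂ)
    (ContinuousLinearMap.comp (ContinuousLinearMap.flip
      (ContinuousLinearMap.smulRightL ℝ E (E [⋀^Fin _]→L[ℝ] ℂ)) η) (θE[B]))

set_option hygiene false in
/-- The model Lefschetz operator `L_B η`. -/
local notation "LopE[" B "]" η:max =>
  ContinuousAlternatingMap.alternatizeUncurryFin (𝕜 := ℝ) (E := E) (F := ℂ) (LfamE[B] η)

set_option hygiene false in
/-- The Lefschetz operator of the family `G` on forms on `M`. -/
local notation "Lform[" G "]" β:max =>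
  @id (MForm 𝓘(ℝ, E) M ℂ (_ + 1 + 1)) (fun x ↦ (LopE[G x] (β x) :))

/-- The complexified Hodge star at a point. -/
local notation "⋆ℂ[" o ", " h "]" η:max =>
  ContinuousLinearMap.compContinuousAlternatingMap Complex.ofRealCLM
      (hodgeStar o h (ContinuousLinearMap.compContinuousAlternatingMap Complex.reCLM η)) +
    Complex.I • ContinuousLinearMap.compContinuousAlternatingMap Complex.ofRealCLM
      (hodgeStar o h (ContinuousLinearMap.compContinuousAlternatingMap Complex.imCLM η))

set_option hygiene false in
/-- The operator `P β = ∂̄*(L β) - L (∂̄* β) - i ∂β` (positive degree). -/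
local notation "KP[" G ", " o ", " h₁ ", " h₃ "]" β:max =>
  (dolbeaultBarAdjoint o h₁ (Lform[G] β) - Lform[G] (dolbeaultBarAdjoint o h₃ β) -
    Complex.I • dolbeault β)

set_option hygiene false in
/-- The operator `P₀ f = ∂̄*(L f) - i ∂f` (degree `0`). -/
local notation "KP₀[" G ", " o ", " h₁ "]" β:max =>
  (dolbeaultBarAdjoint o h₁ (Lform[G] β) - Complex.I • dolbeault β)

section Locality

variable {E : Type*} [NormedAddCommGroup E] [NormedSpace ℂ E]
  {M : Type*} [TopologicalSpace M] [ChartedSpace E M] {k m : ℕ}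

/-- Type components are pointwise: forms agreeing near `z` have type components agreeing near
`z`. [folklore] -/
theorem typeComponent_eventuallyEq (p q : ℕ) {α β : MForm 𝓘(ℝ, E) M ℂ k} {z : M}
    (h : ∀ᶠ w in 𝓝 z, α w = β w) :
    ∀ᶠ w in 𝓝 z, α.typeComponent p q w = β.typeComponent p q w := by
  filter_upwards [h] with w hw
  rw [typeComponent_apply_eq_typeProjAt, typeComponent_apply_eq_typeProjAt]
  exact congrArg (typeProjAt p q) hw

/-- **Locality of `∂`**: forms agreeing near `z` have the same `∂` at `z`. [folklore] -/
theorem dolbeault_congr_of_eventuallyEq {α β : MForm 𝓘(ℝ, E) M ℂ k} {z : M}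
    (h : ∀ᶠ w in 𝓝 z, α w = β w) : dolbeault α z = dolbeault β z := by
  have hpq : ∀ p q, mextDeriv (α.typeComponent p q) z = mextDeriv (β.typeComponent p q) z :=
    fun p q ↦ mextDeriv_congr_of_eventuallyEq (typeComponent_eventuallyEq p q h)
  ext v
  rw [dolbeault_apply_apply, dolbeault_apply_apply]
  refine Finset.sum_congr rfl fun pq _ ↦ ?_
  rw [typeComponent_apply_eq_typeProjAt, typeComponent_apply_eq_typeProjAt, hpq]

/-- Locality of `∂`, germ form. [folklore] -/
theorem dolbeault_eventuallyEq_of_eventuallyEq {α β : MForm 𝓘(ℝ, E) M ℂ k} {z : M}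
    (h : ∀ᶠ w in 𝓝 z, α w = β w) : ∀ᶠ w in 𝓝 z, dolbeault α w = dolbeault β w := by
  filter_upwards [h.eventually_nhds] with w hw
  exact dolbeault_congr_of_eventuallyEq hw

/-- **`∂β z = 0` when every `d(β^{p,q})` vanishes at `z`** (`∂ = ∑ (d β^{p,q})^{p+1,q}`).
[cite: Voisin2002, §2.3.3] -/
theorem dolbeault_apply_eq_zero {β : MForm 𝓘(ℝ, E) M ℂ k} {z : M}
    (h : ∀ p q, p + q = k → mextDeriv (β.typeComponent p q) z = 0) : dolbeault β z = 0 := by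
  ext v
  rw [dolbeault_apply_apply, ContinuousAlternatingMap.coe_zero, Pi.zero_apply]
  refine Finset.sum_eq_zero fun pq hpq ↦ ?_
  rw [typeComponent_apply_eq_typeProjAt, h pq.1 pq.2 (mem_antidiagonal.1 hpq)]
  change (typeProjAt (pq.1 + 1) pq.2 (0 : E [⋀^Fin (k + 1)]→L[ℝ] ℂ)) v = 0
  rw [typeProjAt_zero]
  rfl

variable [FiniteDimensional ℂ E] {n : ℕ} [Fact (finrank ℝ E = n)]
  [RiemannianBundle (fun x : M ↦ TangentSpace 𝓘(ℝ, E) x)]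
  (o : (x : M) → Orientation ℝ (TangentSpace 𝓘(ℝ, E) x) (Fin n))

/-- The complexified Hodge star is pointwise. [folklore] -/
theorem cHodgeStar_eventuallyEq (h : k + m = n) {α β : MForm 𝓘(ℝ, E) M ℂ k} {z : M}
    (hαβ : ∀ᶠ w in 𝓝 z, α w = β w) :
    ∀ᶠ w in 𝓝 z, MForm.cHodgeStar o h α w = MForm.cHodgeStar o h β w := by
  filter_upwards [hαβ] with w hw
  rw [cHodgeStar_apply_pt, cHodgeStar_apply_pt, hw]

/-- **Locality of `∂̄* = -⋆∂⋆`.** [folklore] -/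
theorem dolbeaultBarAdjoint_congr_of_eventuallyEq (h : (k + 1) + m = n)
    {α β : MForm 𝓘(ℝ, E) M ℂ (k + 1)} {z : M} (hαβ : ∀ᶠ w in 𝓝 z, α w = β w) :
    dolbeaultBarAdjoint o h α z = dolbeaultBarAdjoint o h β z := by
  rw [dolbeaultBarAdjoint, dolbeaultBarAdjoint, Pi.neg_apply, Pi.neg_apply, cHodgeStar_apply_pt,
    cHodgeStar_apply_pt, dolbeault_congr_of_eventuallyEq (cHodgeStar_eventuallyEq o h hαβ)]

/-- Locality of `∂̄*`, germ form. [folklore] -/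
theorem dolbeaultBarAdjoint_eventuallyEq (h : (k + 1) + m = n)
    {α β : MForm 𝓘(ℝ, E) M ℂ (k + 1)} {z : M} (hαβ : ∀ᶠ w in 𝓝 z, α w = β w) :
    ∀ᶠ w in 𝓝 z, dolbeaultBarAdjoint o h α w = dolbeaultBarAdjoint o h β w := by
  filter_upwards [hαβ.eventually_nhds] with w hw
  exact dolbeaultBarAdjoint_congr_of_eventuallyEq o h hw

/-- `∂̄*β z = 0` when every `d((⋆β)^{p,q})` vanishes at `z`. [folklore] -/
theorem dolbeaultBarAdjoint_apply_eq_zero (h : (k + 1) + m = n) {β : MForm 𝓘(ℝ, E) M ℂ (k + 1)}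
    {z : M} (hβ : ∀ p q, p + q = m → mextDeriv ((MForm.cHodgeStar o h β).typeComponent p q) z = 0) :
    dolbeaultBarAdjoint o h β z = 0 := by
  rw [dolbeaultBarAdjoint, Pi.neg_apply, cHodgeStar_apply_pt, dolbeault_apply_eq_zero hβ, neg_eq_zero]
  have h0 := cHodgeStarPt_add (o z) (by omega : (m + 1) + k = n)
    (0 : TangentSpace 𝓘(ℝ, E) z [⋀^Fin (m + 1)]→L[ℝ] ℂ) 0
  rw [add_zero] at h0
  exact left_eq_add.1 h0

omit [FiniteDimensional ℂ E] [Fact (finrank ℝ E = n)]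
  [RiemannianBundle fun x : M ↦ TangentSpace 𝓘(ℝ, E) x] in
/-- The Lefschetz operator is pointwise. [folklore] -/
theorem lform_eventuallyEq (G : M → E →L[ℝ] E →L[ℝ] ℝ) {α β : MForm 𝓘(ℝ, E) M ℂ k} {z : M}
    (hαβ : ∀ᶠ w in 𝓝 z, α w = β w) : ∀ᶠ w in 𝓝 z, (Lform[G] α) w = (Lform[G] β) w := by
  filter_upwards [hαβ] with w hw
  rw [lform_apply, lform_apply, hw]

/-- **Locality of `P = [∂̄*, L] - i∂`** (positive degree): forms agreeing near `z` have the same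
`P` at `z`. [cite: Voisin2002, §6.1.1] -/
theorem kaehlerP_congr_of_eventuallyEq (G : M → E →L[ℝ] E →L[ℝ] ℝ) {m₁ m₃ : ℕ}
    (h₁ : (k + 1 + 1 + 1) + m₁ = n) (h₃ : (k + 1) + m₃ = n) {α β : MForm 𝓘(ℝ, E) M ℂ (k + 1)}
    {z : M} (hαβ : ∀ᶠ w in 𝓝 z, α w = β w) :
    (KP[G, o, h₁, h₃] α) z = (KP[G, o, h₁, h₃] β) z := by
  rw [Pi.sub_apply, Pi.sub_apply, Pi.smul_apply, Pi.sub_apply, Pi.sub_apply, Pi.smul_apply,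
    dolbeaultBarAdjoint_congr_of_eventuallyEq o h₁ (lform_eventuallyEq G hαβ),
    lform_apply, lform_apply, dolbeaultBarAdjoint_congr_of_eventuallyEq o h₃ hαβ,
    dolbeault_congr_of_eventuallyEq hαβ]

/-- **Locality of `P₀ = ∂̄* L - i∂`** (degree `0`). [cite: Voisin2002, §6.1.1] -/
theorem kaehlerP_congr_of_eventuallyEq_zero (G : M → E →L[ℝ] E →L[ℝ] ℝ) {m₁ : ℕ}
    (h₁ : (0 + 1 + 1) + m₁ = n) {α β : MForm 𝓘(ℝ, E) M ℂ 0} {z : M}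
    (hαβ : ∀ᶠ w in 𝓝 z, α w = β w) :
    (KP₀[G, o, h₁] α) z = (KP₀[G, o, h₁] β) z := by
  rw [Pi.sub_apply, Pi.smul_apply, Pi.sub_apply, Pi.smul_apply,
    dolbeaultBarAdjoint_congr_of_eventuallyEq o h₁ (lform_eventuallyEq G hαβ),
    dolbeault_congr_of_eventuallyEq hαβ]

end Locality

section Additivity

variable {E : Type*} [NormedAddCommGroup E] [NormedSpace ℂ E]
  {M : Type*} [TopologicalSpace M] [ChartedSpace E M] {k : ℕ}

/-- `L (∑ βᵢ) = ∑ L βᵢ`. [folklore] -/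
theorem lform_sum (G : M → E →L[ℝ] E →L[ℝ] ℝ) {ι : Type*} (s : Finset ι)
    (β : ι → MForm 𝓘(ℝ, E) M ℂ k) : Lform[G] (∑ i ∈ s, β i) = ∑ i ∈ s, Lform[G] (β i) := by
  classical
  induction s using Finset.induction_on with
  | empty => rw [sum_empty, sum_empty, lform_zero]
  | insert a s ha ih => rw [sum_insert ha, sum_insert ha, lform_add, ih]

variable [FiniteDimensional ℂ E] {n : ℕ} [Fact (finrank ℝ E = n)]
  [RiemannianBundle (fun x : M ↦ TangentSpace 𝓘(ℝ, E) x)]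
  (o : (x : M) → Orientation ℝ (TangentSpace 𝓘(ℝ, E) x) (Fin n))
  [IsManifold 𝓘(ℝ, E) ∞ M] [IsManifold 𝓘(ℂ, E) ω M]
  [IsContMDiffRiemannianBundle 𝓘(ℝ, E) ∞ E (fun x : M ↦ TangentSpace 𝓘(ℝ, E) x)]

/-- `∂̄* (∑ βᵢ) = ∑ ∂̄* βᵢ` on smooth forms (local copy of `dolbeaultBarAdjoint_sum` of
`KaehlerHodgeAdjointProofs.lean`, to avoid its heavy import closure). [folklore] -/
private theorem dolbeaultBarAdjoint_sum_aux (ho : IsSmoothForm (riemannianVolumeForm o)) {m : ℕ}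
    (h : (k + 1) + m = n) {ι : Type*} (s : Finset ι) (β : ι → MForm 𝓘(ℝ, E) M ℂ (k + 1))
    (hβ : ∀ i ∈ s, IsSmoothForm (β i)) :
    dolbeaultBarAdjoint o h (∑ i ∈ s, β i) = ∑ i ∈ s, dolbeaultBarAdjoint o h (β i) := by
  classical
  induction s using Finset.induction_on with
  | empty => rw [sum_empty, sum_empty, dolbeaultBarAdjoint_zero o h]
  | insert a s ha ih =>
    have hs : ∀ i ∈ s, IsSmoothForm (β i) := fun i hi ↦ hβ i (mem_insert_of_mem hi)
    have hsum : IsSmoothForm (∑ i ∈ s, β i) :=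
      (smoothForms 𝓘(ℝ, E) M ℂ (k + 1)).sum_mem fun i hi ↦ hs i hi
    rw [sum_insert ha, sum_insert ha,
      dolbeaultBarAdjoint_add o ho h (hβ a (mem_insert_self a s)) hsum, ih hs]

/-- **Additivity of `P` over finite sums of smooth forms** (positive degree). [folklore] -/
theorem kaehlerP_sum (G : M → E →L[ℝ] E →L[ℝ] ℝ)
    (hG : ∀ (x : M) (v w : TangentSpace 𝓘(ℝ, E) x), G x v w = inner ℝ v w)
    (ho : IsSmoothForm (riemannianVolumeForm o)) {m₁ m₃ : ℕ}
    (h₁ : (k + 1 + 1 + 1) + m₁ = n) (h₃ : (k + 1) + m₃ = n) {ι : Type*} (s : Finset ι)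
    (β : ι → MForm 𝓘(ℝ, E) M ℂ (k + 1)) (hβ : ∀ i ∈ s, IsSmoothForm (β i)) (z : M) :
    (KP[G, o, h₁, h₃] (∑ i ∈ s, β i)) z = ∑ i ∈ s, (KP[G, o, h₁, h₃] (β i)) z := by
  have hL : ∀ i ∈ s, IsSmoothForm (Lform[G] (β i)) := fun i hi ↦ isSmoothForm_lform G hG (hβ i hi)
  rw [lform_sum, dolbeaultBarAdjoint_sum_aux o ho h₁ s _ hL, dolbeaultBarAdjoint_sum_aux o ho h₃ s _ hβ,
    lform_sum, dolbeault_sum s β hβ, smul_sum, ← sum_sub_distrib, ← sum_sub_distrib]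
  rw [Finset.sum_apply]

/-- **Additivity of `P₀` over finite sums of smooth functions-forms** (degree `0`). [folklore] -/
theorem kaehlerP_sum_zero (G : M → E →L[ℝ] E →L[ℝ] ℝ)
    (hG : ∀ (x : M) (v w : TangentSpace 𝓘(ℝ, E) x), G x v w = inner ℝ v w)
    (ho : IsSmoothForm (riemannianVolumeForm o)) {m₁ : ℕ}
    (h₁ : (0 + 1 + 1) + m₁ = n) {ι : Type*} (s : Finset ι)
    (β : ι → MForm 𝓘(ℝ, E) M ℂ 0) (hβ : ∀ i ∈ s, IsSmoothForm (β i)) (z : M) :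
    (KP₀[G, o, h₁] (∑ i ∈ s, β i)) z = ∑ i ∈ s, (KP₀[G, o, h₁] (β i)) z := by
  have hL : ∀ i ∈ s, IsSmoothForm (Lform[G] (β i)) := fun i hi ↦ isSmoothForm_lform G hG (hβ i hi)
  rw [lform_sum, dolbeaultBarAdjoint_sum_aux o ho h₁ s _ hL, dolbeault_sum s β hβ, smul_sum,
    ← sum_sub_distrib]
  rw [Finset.sum_apply]

/-- **Frame reduction** (positive degree): if `P` is `C^∞`-linear at `z` on the smooth forms
`Θᵢ` (`hlin`, from `kaehlerP_fun_smul`) and `P Θᵢ z = 0`, then `P (∑ ρᵢ • Θᵢ) z = 0` for smooth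
real functions `ρᵢ`. [cite: Voisin2002, §6.1.1 Prop. 6.5] -/
theorem kaehlerP_sum_fun_smul_eq_zero (G : M → E →L[ℝ] E →L[ℝ] ℝ)
    (hG : ∀ (x : M) (v w : TangentSpace 𝓘(ℝ, E) x), G x v w = inner ℝ v w)
    (ho : IsSmoothForm (riemannianVolumeForm o)) {m₁ m₃ : ℕ}
    (h₁ : (k + 1 + 1 + 1) + m₁ = n) (h₃ : (k + 1) + m₃ = n) {ι : Type*} (s : Finset ι)
    (Θ : ι → MForm 𝓘(ℝ, E) M ℂ (k + 1)) (hΘ : ∀ i ∈ s, IsSmoothForm (Θ i))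
    (ρ : ι → M → ℝ) (hρ : ∀ i ∈ s, ContMDiff 𝓘(ℝ, E) 𝓘(ℝ, ℝ) ∞ (ρ i)) (z : M)
    (hlin : ∀ i ∈ s, (KP[G, o, h₁, h₃] (ρ i • Θ i)) z = ρ i z • (KP[G, o, h₁, h₃] (Θ i)) z)
    (hzero : ∀ i ∈ s, (KP[G, o, h₁, h₃] (Θ i)) z = 0) :
    (KP[G, o, h₁, h₃] (∑ i ∈ s, ρ i • Θ i)) z = 0 := by
  have hs : ∀ i ∈ s, IsSmoothForm (ρ i • Θ i) := fun i hi ↦ (hΘ i hi).fun_smul' (hρ i hi)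
  rw [kaehlerP_sum o G hG ho h₁ h₃ s _ hs z]
  refine Finset.sum_eq_zero fun i hi ↦ ?_
  rw [hlin i hi, hzero i hi, smul_zero]

/-- **Frame reduction**, degree `0`. [cite: Voisin2002, §6.1.1 Prop. 6.5] -/
theorem kaehlerP_sum_fun_smul_eq_zero_zero (G : M → E →L[ℝ] E →L[ℝ] ℝ)
    (hG : ∀ (x : M) (v w : TangentSpace 𝓘(ℝ, E) x), G x v w = inner ℝ v w)
    (ho : IsSmoothForm (riemannianVolumeForm o)) {m₁ : ℕ}
    (h₁ : (0 + 1 + 1) + m₁ = n) {ι : Type*} (s : Finset ι)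
    (Θ : ι → MForm 𝓘(ℝ, E) M ℂ 0) (hΘ : ∀ i ∈ s, IsSmoothForm (Θ i))
    (ρ : ι → M → ℝ) (hρ : ∀ i ∈ s, ContMDiff 𝓘(ℝ, E) 𝓘(ℝ, ℝ) ∞ (ρ i)) (z : M)
    (hlin : ∀ i ∈ s, (KP₀[G, o, h₁] (ρ i • Θ i)) z = ρ i z • (KP₀[G, o, h₁] (Θ i)) z)
    (hzero : ∀ i ∈ s, (KP₀[G, o, h₁] (Θ i)) z = 0) :
    (KP₀[G, o, h₁] (∑ i ∈ s, ρ i • Θ i)) z = 0 := by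
  have hs : ∀ i ∈ s, IsSmoothForm (ρ i • Θ i) := fun i hi ↦ (hΘ i hi).fun_smul' (hρ i hi)
  rw [kaehlerP_sum_zero o G hG ho h₁ s _ hs z]
  refine Finset.sum_eq_zero fun i hi ↦ ?_
  rw [hlin i hi, hzero i hi, smul_zero]

end Additivity

end Literature.NumberTheory.Transcendental
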